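import Literature.AlgebraicGeometry.Frobenioids.FiberProducts
import Literature.AlgebraicGeometry.Frobenioids.PerfFactorial
import Literature.AlgebraicGeometry.Frobenioids.AngularFrobenioids
import HarnessLib

/-!
# Frobenioids II, Example 3.3: the relative categories `C`, `C^Λ`, `A`, `N`, `R` over a base `D → D₀`

Mochizuki, *The geometry of Frobenioids II: poly-Frobenioids*, Kyushu J. Math. **62** (2008)
401–460, §3, Example 3.3 (i)–(v), author's text pp. 27–29 [cite: MochizukiFrdII2008, Ex 3.3 pp.27-29]:

* (i) p. 28: "if `D` is any connected, totally epimorphic category, and `D → D₀` is a functor, then by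
  setting `C := C₀ ×_{D₀} D`; `Φ := Φ₀|_D` we obtain a pre-Frobenioid structure `C → F_Φ` on `C`";
* (ii) p. 28: "`C^ℤ := C`; `C^ℚ := C^pf`; `C^ℝ := C^rlf` … an *archimedean Frobenioid*";
* (iii) pp. 28–29: "`A ⊆ C` … the respective subcategories determined by the isometries … an
  *angular Frobenioid*. Write `N := A^lin ⊆ A` … a *non-rigidified angloid*";
* (iv) p. 29: "`R := R₀ ×_{D₀} D` … a *rigidified angloid* …; also, we shall apply the notation
  `O^▷(−)`, `O^×(−)` to objects of `N`, `R` to denote the monoids of base-identity endomorphisms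
  [resp.] automorphisms";
* (v) p. 29: slit morphisms.

**Rendering.** `C := C₀ ×_{D₀} D` with its structure `C → F_{Φ₀|_D}` IS found's [FrdI] Prop. 1.6
construction `PreFrobenioid.FiberProduct C0.toElem π` / `fiberProductFunctor` / `restrictMonoid`
(no second copy). `A`, `N` are Mathlib `WideSubcategory`s; `A`'s own Frobenioid structure is over the
zero divisor monoid `zeroMonoid D` ("of group-like type", `PreFrobenioid.isometriesToElem`). `R := R₀ ×_{D₀} D` is the
§0 categorical fiber product `CFP`. The perfection `C^pf` ([FrdI] Def. 3.1 (iii), abc-iut-L1-t3's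
`PerfectionData` interface) and the realification `C^rlf` ([FrdI] Prop. 5.3, abc-iut-L1-t5) are not
constructed in the tree: `C^Λ` for `Λ ∈ {ℚ, ℝ}` is therefore typed over an INTERFACE
`LambdaCompletion` (a category with a pre-Frobenioid structure over `D` receiving a functor from `C`;
TODO-merge: L1-t3 `PerfectionData`, L1-t5 realification), and `archFrobenioid Λ` selects
`C` / the perfection datum / the realification datum. Frobenioid-theoretic words applied to `N`, `R`
refer to images in `C` (p. 29), whence the functors `N.toC`, `R.toC`.

Deliberately NOT here: the printed CLAIMS of (ii)–(v) and Remark 3.3.1 (named statements, file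
`ArchimedeanFrobenioidStatements.lean`).
-/

namespace Literature.AlgebraicGeometry.Frobenioids

open CategoryTheory Opposite
open scoped Pointwise NNReal

noncomputable section

namespace ArchFrd

universe v u

variable {D : Type u} [Category.{v} D] (π : D ⥤ D0)

/-! ### Example 3.3 (i), relative: `C := C₀ ×_{D₀} D`, `Φ := Φ₀|_D`, `C → F_Φ` -/

/-- `C := C₀ ×_{D₀} D` for a functor `π : D → D₀` (FrdII Ex. 3.3 (i), p. 28) — found's categorical
fiber product of [FrdI] Prop. 1.6 applied to `C₀ → F_{Φ₀}`. [cite: MochizukiFrdII2008, Ex 3.3 (i) p.28] -/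
abbrev C : Type u := PreFrobenioid.FiberProduct C0.toElem π

/-- `Φ := Φ₀|_D` (FrdII Ex. 3.3 (i), p. 28): the constant monoid `ℝ_{≥0}` on `D`.
[cite: MochizukiFrdII2008, Ex 3.3 (i) p.28] -/
abbrev Φ : Dᵒᵖ ⥤ CommMonCat.{0} := restrictMonoid Φ₀ π

namespace C

/-- "we obtain a pre-Frobenioid structure `C → F_Φ` on `C`" (FrdII Ex. 3.3 (i), p. 28): found's
`fiberProductFunctor` ([FrdI] Prop. 1.6 (ii)). [cite: MochizukiFrdII2008, Ex 3.3 (i) p.28] -/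
abbrev toElem : C π ⥤ ElemFrobenioid (Φ π) := PreFrobenioid.fiberProductFunctor C0.toElem π

/-- The projection `C → D` to the base category. [cite: MochizukiFrdII2008, Ex 3.3 (i) p.28] -/
abbrev toBase : C π ⥤ D := PreFrobenioid.baseFunctor (toElem π)

/-- The projection `C → C₀`. [cite: MochizukiFrdII2008, Ex 3.3 (i) p.28] -/
abbrev toC0 : C π ⥤ C0 := CFP.proj₁ _ _

/-- The statement "`C → F_Φ` is a pre-Frobenioid structure" ([FrdI] Def. 1.1 (iv)) for a connected,
totally epimorphic base `D` (FrdII Ex. 3.3 (i), p. 28) — named statement over found's `IsPreFrobenioid`.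
[cite: MochizukiFrdII2008, Ex 3.3 (i) p.28] -/
def PreFrobenioidStructure : Prop :=
  IsGraphConnected D → IsTotallyEpimorphic D → IsPreFrobenioid (Φ π) (toElem π)

end C

/-! ### Example 3.3 (ii): `C^Λ` -/

/-- INTERFACE for the completions `C^pf` (perfection, [FrdI] Def. 3.1 (iii); TODO-merge abc-iut-L1-t3
`PerfectionData`) and `C^rlf` (realification, [FrdI] Prop. 5.3; TODO-merge abc-iut-L1-t5) of `C`
used in FrdII Ex. 3.3 (ii), p. 28: a category with a pre-Frobenioid structure over `D` together with the
natural functor from `C` lying over `D`. [cite: MochizukiFrdII2008, Ex 3.3 (ii) p.28] -/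
structure LambdaCompletion where
  /-- the category `C^pf` resp. `C^rlf` -/
  cat : Type u
  [inst : Category.{v} cat]
  /-- its divisor monoid on `D` (`Φ^pf` resp. `Φ^rlf`) -/
  monoid : Dᵒᵖ ⥤ CommMonCat.{0}
  /-- its pre-Frobenioid structure -/
  str : cat ⥤ ElemFrobenioid monoid
  /-- the natural functor `C → C^pf` resp. `C → C^rlf` -/
  fromC : C π ⥤ cat
  /-- … lying over `D` -/
  over : fromC ⋙ PreFrobenioid.baseFunctor str = C.toBase π

namespace LambdaCompletion

/-- The category of a completion datum is a category. [cite: MochizukiFrdII2008, Ex 3.3 (ii) p.28] -/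
instance instCategoryCat (L : LambdaCompletion π) : Category L.cat := L.inst

/-- `C` itself as a (trivial) completion datum: the case `Λ = ℤ`, "`C^ℤ := C`".
[cite: MochizukiFrdII2008, Ex 3.3 (ii) p.28] -/
def self : LambdaCompletion π where
  cat := C π
  monoid := Φ π
  str := C.toElem π
  fromC := 𝟭 _
  over := rfl

end LambdaCompletion

/-- **The archimedean Frobenioid `C^Λ`** (FrdII Ex. 3.3 (ii), p. 28): "`C^ℤ := C`; `C^ℚ := C^pf`;
`C^ℝ := C^rlf` [cf. [Mzk5], Proposition 5.3]. We shall refer to a Frobenioid `C^Λ` as an *archimedean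
Frobenioid*" — as a function of the supplied perfection datum `pf` and realification datum `rlf`
(INTERFACE, see `LambdaCompletion`). [cite: MochizukiFrdII2008, Ex 3.3 (ii) p.28] -/
def archFrobenioid (pf rlf : LambdaCompletion π) : MonoidType → LambdaCompletion π
  | .Z => LambdaCompletion.self π
  | .Q => pf
  | .R => rlf

/-- `C^ℤ = C`. [cite: MochizukiFrdII2008, Ex 3.3 (ii) p.28] -/
@[simp] theorem archFrobenioid_Z (pf rlf : LambdaCompletion π) :
    archFrobenioid π pf rlf .Z = LambdaCompletion.self π := rfl

/-! ### Example 3.3 (iii): `A ⊆ C` (isometries), `N := A^lin` -/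

/-- `A ⊆ C`, "the respective subcategories determined by the isometries" — the *angular Frobenioid*
(FrdII Ex. 3.3 (iii), pp. 28–29). [cite: MochizukiFrdII2008, Ex 3.3 (iii) p.28] -/
abbrev A : Type u := WideSubcategory (PreFrobenioid.isometricMorphisms (C.toElem π))

namespace A

/-- The inclusion `A ⊆ C`. [cite: MochizukiFrdII2008, Ex 3.3 (iii) p.28] -/
abbrev ι : A π ⥤ C π := wideSubcategoryInclusion _

/-- The Frobenioid structure of `A` "over the base category `D`, which is, in fact, of group-like
type" (FrdII Ex. 3.3 (iii), p. 29): `(Base, 0, deg_Fr)` over the zero divisor monoid.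
[cite: MochizukiFrdII2008, Ex 3.3 (iii) p.29] -/
abbrev toElem : A π ⥤ ElemFrobenioid (zeroMonoid D : Dᵒᵖ ⥤ CommMonCat.{0}) :=
  PreFrobenioid.isometriesToElem (C.toElem π)

/-- The projection `A → D`. [cite: MochizukiFrdII2008, Ex 3.3 (iii) p.29] -/
abbrev toBase : A π ⥤ D := PreFrobenioid.baseFunctor (toElem π)

/-- "of group-like type" for `A` — PROVED (zero divisor monoid). [cite: MochizukiFrdII2008, Ex 3.3 (iii) p.29] -/
theorem isOfType_isGroupLikeObj :
    PreFrobenioid.IsOfType (PreFrobenioid.IsGroupLikeObj (toElem π)) :=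
  PreFrobenioid.isGroupLikeObj_isometriesToElem (C.toElem π)

/-- `A → A₀ ×_{D₀} D` on objects and arrows: `(X, d, α) ↦ (X, d, α)` (an isometry of `C` has an
isometric `C₀`-component, the pull-backs of `Φ₀` being identities).
[cite: MochizukiFrdII2008, Ex 3.3 (iii) p.29] -/
def toCFP : A π ⥤ CFP A0.toD0 π where
  obj X := ⟨⟨X.obj.fst⟩, X.obj.snd, X.obj.iso⟩
  map f := ⟨⟨f.1.fst, f.2⟩, f.1.snd, f.1.w⟩

/-- `A₀ ×_{D₀} D → A`. [cite: MochizukiFrdII2008, Ex 3.3 (iii) p.29] -/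
def ofCFP : CFP A0.toD0 π ⥤ A π where
  obj Y := ⟨⟨Y.fst.obj, Y.snd, Y.iso⟩⟩
  map g := ⟨⟨g.fst.1, g.snd, g.w⟩, g.fst.2⟩

/-- **Ex. 3.3 (iii)**: "we have a natural equivalence of categories `A ⥲ A₀ ×_{D₀} D`" — CONSTRUCTED
(the two functors above are mutually inverse on the nose). [cite: MochizukiFrdII2008, Ex 3.3 (iii) p.29] -/
def equivCFP : A π ≌ CFP A0.toD0 π :=
  CategoryTheory.Equivalence.mk (toCFP π) (ofCFP π)
    (NatIso.ofComponents (fun _ => Iso.refl _)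
      (fun f => (Category.comp_id f).trans (Category.id_comp f).symm))
    (NatIso.ofComponents (fun _ => Iso.refl _)
      (fun f => (Category.comp_id f).trans (Category.id_comp f).symm))

end A

/-- `N := A^lin ⊆ A`, "the respective subcategories determined by the linear morphisms — cf. [Mzk5],
Definition 1.2, (iv)" — the *non-rigidified angloid* over `D` (FrdII Ex. 3.3 (iii), p. 29).
[cite: MochizukiFrdII2008, Ex 3.3 (iii) p.29] -/
abbrev N : Type u := WideSubcategory (PreFrobenioid.linearMorphisms (A.toElem π))

namespace N

/-- The inclusion `N ⊆ A`. [cite: MochizukiFrdII2008, Ex 3.3 (iii) p.29] -/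
abbrev ι : N π ⥤ A π := wideSubcategoryInclusion _

/-- "the natural functor `N → C`" (FrdII Ex. 3.3 (iv), p. 29). [cite: MochizukiFrdII2008, Ex 3.3 (iv) p.29] -/
abbrev toC : N π ⥤ C π := ι π ⋙ A.ι π

/-- The projection `N → D`. [cite: MochizukiFrdII2008, Ex 3.3 (iii) p.29] -/
abbrev toBase : N π ⥤ D := toC π ⋙ C.toBase π

/-- `O^▷(X)` for `X ∈ Ob(N)`: "the monoid of base-identity endomorphisms [i.e., as objects of `N`]"
(FrdII Ex. 3.3 (iv), p. 29; Mathlib's `End X` multiplies by `f * g = g ≫ f`).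
[cite: MochizukiFrdII2008, Ex 3.3 (iv) p.29] -/
def endMonoid (X : N π) : Submonoid (End X) where
  carrier := {φ | (toBase π).map φ = 𝟙 _}
  one_mem' := (toBase π).map_id X
  mul_mem' {f g} hf hg := by
    change (toBase π).map (g ≫ f) = 𝟙 _
    rw [Functor.map_comp, hf, hg, Category.comp_id]

/-- `O^×(X)` for `X ∈ Ob(N)`: the group of base-identity automorphisms (FrdII Ex. 3.3 (iv), p. 29).
[cite: MochizukiFrdII2008, Ex 3.3 (iv) p.29] -/
def autGroup (X : N π) : Subgroup (Aut X) where
  carrier := {α | (toBase π).map α.hom = 𝟙 _}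
  one_mem' := (toBase π).map_id X
  mul_mem' {α β} hα hβ := by
    change (toBase π).map (β.hom ≫ α.hom) = 𝟙 _
    rw [Functor.map_comp, hα, hβ, Category.comp_id]
  inv_mem' {α} hα := by
    change (toBase π).map α.inv = 𝟙 _
    have h : (toBase π).map α.hom ≫ (toBase π).map α.inv = 𝟙 _ := by
      rw [← (toBase π).map_comp, Iso.hom_inv_id, CategoryTheory.Functor.map_id]
    rw [show (toBase π).map α.hom = 𝟙 _ from hα, Category.id_comp] at h
    exact h

/-- `N → N₀ ×_{D₀} D` (linearity of an arrow of `A` is linearity of its `C₀`-component).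
[cite: MochizukiFrdII2008, Ex 3.3 (iii) p.29] -/
def toCFP : N π ⥤ CFP N0.toD0 π where
  obj X := ⟨⟨⟨X.obj.obj.fst⟩⟩, X.obj.obj.snd, X.obj.obj.iso⟩
  map f := ⟨⟨⟨f.1.1.fst, f.1.2⟩, f.2⟩, f.1.1.snd, f.1.1.w⟩

/-- `N₀ ×_{D₀} D → N`. [cite: MochizukiFrdII2008, Ex 3.3 (iii) p.29] -/
def ofCFP : CFP N0.toD0 π ⥤ N π where
  obj Y := ⟨⟨⟨Y.fst.obj.obj, Y.snd, Y.iso⟩⟩⟩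
  map g := ⟨⟨⟨g.fst.1.1, g.snd, g.w⟩, g.fst.1.2⟩, g.fst.2⟩

/-- **Ex. 3.3 (iii)**: "there is a natural equivalence of categories `N ⥲ N₀ ×_{D₀} D`" —
CONSTRUCTED. [cite: MochizukiFrdII2008, Ex 3.3 (iii) p.29] -/
def equivCFP : N π ≌ CFP N0.toD0 π :=
  CategoryTheory.Equivalence.mk (toCFP π) (ofCFP π)
    (NatIso.ofComponents (fun _ => Iso.refl _)
      (fun f => (Category.comp_id f).trans (Category.id_comp f).symm))
    (NatIso.ofComponents (fun _ => Iso.refl _)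
      (fun f => (Category.comp_id f).trans (Category.id_comp f).symm))

end N

/-! ### Example 3.3 (iv): `R := R₀ ×_{D₀} D`, the rigidified angloid -/

/-- `R := R₀ ×_{D₀} D`, the *rigidified angloid* over `D` (FrdII Ex. 3.3 (iv), p. 29): the §0
categorical fiber product of `R₀ → D₀` with `π`. [cite: MochizukiFrdII2008, Ex 3.3 (iv) p.29] -/
abbrev R : Type u := CFP R0.toD0 π

namespace R

/-- The projection `R → D`. [cite: MochizukiFrdII2008, Ex 3.3 (iv) p.29] -/
abbrev toBase : R π ⥤ D := CFP.proj₂ _ _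

/-- The projection `R → R₀`. [cite: MochizukiFrdII2008, Ex 3.3 (iv) p.29] -/
abbrev toR0 : R π ⥤ R0 := CFP.proj₁ _ _

/-- "the natural functor `R → C`" (FrdII Ex. 3.3 (iv), p. 29): `R₀ ×_{D₀} D → C₀ ×_{D₀} D` induced by
`R₀ → C₀`. [cite: MochizukiFrdII2008, Ex 3.3 (iv) p.29] -/
def toC : R π ⥤ C π where
  obj X := ⟨R0.toC0.obj X.fst, X.snd, X.iso⟩
  map f := ⟨R0.toC0.map f.fst, f.snd, f.w⟩

/-- `R → C` lies over `D`. [cite: MochizukiFrdII2008, Ex 3.3 (iv) p.29] -/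
theorem toC_toBase : toC π ⋙ C.toBase π = toBase π := rfl

/-- `O^▷(X)` for `X ∈ Ob(R)`: the monoid of base-identity endomorphisms (FrdII Ex. 3.3 (iv), p. 29).
[cite: MochizukiFrdII2008, Ex 3.3 (iv) p.29] -/
def endMonoid (X : R π) : Submonoid (End X) where
  carrier := {φ | (toBase π).map φ = 𝟙 _}
  one_mem' := (toBase π).map_id X
  mul_mem' {f g} hf hg := by
    change (toBase π).map (g ≫ f) = 𝟙 _
    rw [Functor.map_comp, hf, hg, Category.comp_id]

/-- `O^×(X)` for `X ∈ Ob(R)`: the group of base-identity automorphisms (FrdII Ex. 3.3 (iv), p. 29).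
[cite: MochizukiFrdII2008, Ex 3.3 (iv) p.29] -/
def autGroup (X : R π) : Subgroup (Aut X) where
  carrier := {α | (toBase π).map α.hom = 𝟙 _}
  one_mem' := (toBase π).map_id X
  mul_mem' {α β} hα hβ := by
    change (toBase π).map (β.hom ≫ α.hom) = 𝟙 _
    rw [Functor.map_comp, hα, hβ, Category.comp_id]
  inv_mem' {α} hα := by
    change (toBase π).map α.inv = 𝟙 _
    have h : (toBase π).map α.hom ≫ (toBase π).map α.inv = 𝟙 _ := by
      rw [← (toBase π).map_comp, Iso.hom_inv_id, CategoryTheory.Functor.map_id]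
    rw [show (toBase π).map α.hom = 𝟙 _ from hα, Category.id_comp] at h
    exact h

end R

/-! ### Example 3.3 (v): slit morphisms -/

/-- An angular region "determined by the complement in `S¹` of a single element of `S¹`"
(FrdII Ex. 3.3 (v), p. 29). [cite: MochizukiFrdII2008, Ex 3.3 (v) p.29] -/
def IsSlitRegion (A : AngularRegion ℂ) : Prop := ∃ z : normOneSubgroup ℂ, A.dir = {z}ᶜ

/-- A *slit morphism* of `C`-data: an isotropic hull (for `C → F_Φ`) of an object whose angular region
is a slit region (FrdII Ex. 3.3 (v), p. 29). [cite: MochizukiFrdII2008, Ex 3.3 (v) p.29] -/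
def C.IsSlitMorphism {X Y : C π} (φ : X ⟶ Y) : Prop :=
  PreFrobenioid.IsIsotropicHull (C.toElem π) φ ∧ IsSlitRegion X.fst.region

/-- A *slit morphism* of `A`: "any morphism of `F` that is obtained as the isotropic hull of an object of
`F` whose angular region is determined by the complement in `S¹` of a single element of `S¹`"
(FrdII Ex. 3.3 (v), p. 29), `F = A` with its own Frobenioid structure.
[cite: MochizukiFrdII2008, Ex 3.3 (v) p.29] -/
def A.IsSlitMorphism {X Y : A π} (φ : X ⟶ Y) : Prop :=
  PreFrobenioid.IsIsotropicHull (A.toElem π) φ ∧ IsSlitRegion X.obj.fst.region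

/-- A *slit morphism* of `N` (FrdII Ex. 3.3 (v), p. 29; Frobenioid-theoretic terms for `N` refer to
images in `C`, p. 29). [cite: MochizukiFrdII2008, Ex 3.3 (v) p.29] -/
def N.IsSlitMorphism {X Y : N π} (φ : X ⟶ Y) : Prop := C.IsSlitMorphism π ((N.toC π).map φ)

/-- A *slit morphism* of `R` (FrdII Ex. 3.3 (v), p. 29; Frobenioid-theoretic terms for `R` refer to
images in `C`, p. 29). [cite: MochizukiFrdII2008, Ex 3.3 (v) p.29] -/
def R.IsSlitMorphism {X Y : R π} (φ : X ⟶ Y) : Prop := C.IsSlitMorphism π ((R.toC π).map φ)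

end ArchFrd

end

end Literature.AlgebraicGeometry.Frobenioids
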